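import Mathlib
import Summits.AtomisticToContinuum.FouriersLaw.Theses.EmbeddedDrudeMourre
import Summits.AtomisticToContinuum.FouriersLaw.Theorems.EmbeddedDrudeMourreDrudeDissolutionStubExcursionSecondDifferencePlaneSheetRegular
import HarnessLib

/-!
# Non-degeneracy of a transversal coordinate along the exchange planes and the diagonal
# (stub B1b″ of line `kinetic-polymer-gas-on-the-time-axis`, step L7b of the gradient floor (C4))
(crux `EmbeddedDrudeMourre.DrudeDissolution`, item stmt-AtomisticToContinuum-12593; `--supports` file, closes
nothing; lead c13)

WHAT. Let `A ∈ C¹(ℝ³)` be linked on a translate of the first exchange plane to the restricted sheet function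
`H₀(x,y) = 2(ω(x)ω(y)+ω₂+2)cos((x+y)/2) − 4cos((x−y)/2)` by `A(x, x+c, y)·G(x,y) = τ·H₀(x,y)`,
`G = (ω(x)+ω(y))ω(x)ω(y)`, `τ ≠ 0` (for the twin's `A = 8H/((Σω)(ω₁ω₂+ω₃ω₄))` this holds with `c = 2πn`,
`τ = ±2`). Then at every zero of `A` on that plane the TANGENTIAL derivative of `A` does not vanish
(`tangential_nondeg_fst`: `∂A/∂(1,1,0) ≠ 0 ∨ ∂A/∂(0,0,1) ≠ 0`), because `{H₀ = 0}` is a regular curve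
(`sheetFn_plane_regular`); the same on translates of the second plane `A(x, y+c, y)` (`tangential_nondeg_snd`:
directions `(1,0,0)`, `(0,1,1)`); and on a translate of the diagonal, `A(x, x+c, x+c′)·G(x,x) = τ·H₀(x,x)`, every zero
of `A` has `∂A/∂(1,1,1) ≠ 0` (`diagonal_nondeg`), because a diagonal zero of `H₀` is a triple point `cos x = c*` where
the diagonal derivative is `4 sin x (2cos x − ω₂ − 2) ≠ 0` (`sheetFn_diag_deriv_ne_zero`). These discharge the
non-degeneracy hypotheses of the local floors `gradient_floor_local_comoving(_snd)` and `gradient_floor_local_det`.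

HOW. Differentiate the product identity along the relevant line through the zero (product rule with `A = 0` kills the
`G′` term; chain rule `HasFDerivAt.comp_hasDerivAt`), compare with the derivative of `τ·H₀` along the same line
(uniqueness of derivatives).
-/

noncomputable section

open Set Real Topology
open Literature.MathematicalPhysics.KineticTheory
open Literature.MathematicalPhysics.KineticTheory.PhononBoltzmann

namespace Summit.AtomisticToContinuum.FouriersLaw.Theorems.DrudeDissolution.KineticPolymerGasOnTheTimeAxis

/-- Differentiability of the restricted sheet function `H₀` (as a function on `ℝ × ℝ`). [folklore] -/
theorem differentiable_sheetFn_plane {ω₂ : ℝ} (hω : 0 < ω₂) :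
    Differentiable ℝ (fun q : ℝ × ℝ => 2 * (dispersion ω₂ q.1 * dispersion ω₂ q.2 + ω₂ + 2) *
      Real.cos ((q.1 + q.2) / 2) - 4 * Real.cos ((q.1 - q.2) / 2)) := by
  have hd : Differentiable ℝ (dispersion ω₂) := fun k => (hasDerivAt_dispersion hω k).differentiableAt
  have c1 : Differentiable ℝ fun q : ℝ × ℝ => dispersion ω₂ q.1 := hd.comp differentiable_fst
  have c2 : Differentiable ℝ fun q : ℝ × ℝ => dispersion ω₂ q.2 := hd.comp differentiable_snd
  have c3 : Differentiable ℝ fun q : ℝ × ℝ => Real.cos ((q.1 + q.2) / 2) := by fun_prop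
  have c4 : Differentiable ℝ fun q : ℝ × ℝ => 4 * Real.cos ((q.1 - q.2) / 2) := by fun_prop
  have c5 : Differentiable ℝ fun q : ℝ × ℝ => 2 * (dispersion ω₂ q.1 * dispersion ω₂ q.2 + ω₂ + 2) := by
    have := ((c1.mul c2).add_const ω₂).add_const 2
    exact this.const_mul 2
  exact (c5.mul c3).sub c4

/-- A linear functional on `ℝ × ℝ` vanishing on the two basis vectors is zero. [folklore] -/
theorem clm_two_eq_zero_of_basis {L : ℝ × ℝ →L[ℝ] ℝ} (h1 : L (1, 0) = 0) (h2 : L (0, 1) = 0) : L = 0 := by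
  refine ContinuousLinearMap.ext fun x => ?_
  obtain ⟨a, b⟩ := x
  have : ((a, b) : ℝ × ℝ) = a • ((1, 0) : ℝ × ℝ) + b • ((0, 1) : ℝ × ℝ) := by
    ext <;> simp
  rw [this, map_add, map_smul, map_smul, h1, h2]
  simp

/-! ### Along the first exchange plane -/

/-- **Registered sub-goal `tangential_nondeg_fst` (L7b): tangential non-degeneracy of the transversal coordinate
on a translate of the first exchange plane.** For `ω₂ > 0`, `A ∈ C¹`, `τ ≠ 0` and a constant `c`: if
`A(x, x+c, y)·((ω x + ω y) ω x ω y) = τ·(2(ω x ω y + ω₂ + 2)cos((x+y)/2) − 4cos((x−y)/2))` for all `x y` and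
`A(k₁, k₁+c, k₂) = 0`, then `fderiv A (k₁,k₁+c,k₂) (1,1,0) ≠ 0 ∨ fderiv A (k₁,k₁+c,k₂) (0,0,1) ≠ 0`. [folklore] -/
theorem tangential_nondeg_fst :
    ∀ ω₂ : ℝ, 0 < ω₂ → ∀ (A : ℝ × ℝ × ℝ → ℝ) (c τ k₁ k₂ : ℝ), τ ≠ 0 → ContDiff ℝ 1 A →
      (∀ x y : ℝ, A (x, x + c, y) * ((dispersion ω₂ x + dispersion ω₂ y) * dispersion ω₂ x * dispersion ω₂ y) =
        τ * (2 * (dispersion ω₂ x * dispersion ω₂ y + ω₂ + 2) * Real.cos ((x + y) / 2) - 4 * Real.cos ((x - y) / 2))) →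
      A (k₁, k₁ + c, k₂) = 0 →
      fderiv ℝ A (k₁, k₁ + c, k₂) (1, 1, 0) ≠ 0 ∨ fderiv ℝ A (k₁, k₁ + c, k₂) (0, 0, 1) ≠ 0 := by
  intro ω₂ hω A c τ k₁ k₂ hτ hA hid hA0
  have hd : Differentiable ℝ (dispersion ω₂) := fun k => (hasDerivAt_dispersion hω k).differentiableAt
  have hAd : DifferentiableAt ℝ A (k₁, k₁ + c, k₂) := (hA.differentiable one_ne_zero) _
  set Hf : ℝ × ℝ → ℝ := fun q => 2 * (dispersion ω₂ q.1 * dispersion ω₂ q.2 + ω₂ + 2) * Real.cos ((q.1 + q.2) / 2) -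
      4 * Real.cos ((q.1 - q.2) / 2) with hHf
  have hHd : DifferentiableAt ℝ Hf (k₁, k₂) := (differentiable_sheetFn_plane hω) _
  -- `H₀(k₁,k₂) = 0`
  have hG0 : 0 < (dispersion ω₂ k₁ + dispersion ω₂ k₂) * dispersion ω₂ k₁ * dispersion ω₂ k₂ :=
    mul_pos (mul_pos (add_pos (dispersion_pos hω k₁) (dispersion_pos hω k₂)) (dispersion_pos hω k₁))
      (dispersion_pos hω k₂)
  have hH0 : Hf (k₁, k₂) = 0 := by
    have := hid k₁ k₂
    rw [hA0, zero_mul] at this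
    have h := (mul_eq_zero.1 this.symm).resolve_left hτ
    simpa [hHf] using h
  have hreg := sheetFn_plane_regular ω₂ hω k₁ k₂ hH0
  by_contra hcon
  push Not at hcon
  obtain ⟨h110, h001⟩ := hcon
  apply hreg
  refine clm_two_eq_zero_of_basis ?_ ?_
  · -- differentiate in `x`
    have hℓ : HasDerivAt (fun x : ℝ => ((x, x + c, k₂) : ℝ × ℝ × ℝ)) ((1, 1, 0) : ℝ × ℝ × ℝ) k₁ := by
      refine (hasDerivAt_id k₁).prodMk ((((hasDerivAt_id k₁).add_const c)).prodMk (hasDerivAt_const k₁ k₂))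
    have hφ : HasDerivAt (fun x : ℝ => A (x, x + c, k₂)) (fderiv ℝ A (k₁, k₁ + c, k₂) (1, 1, 0)) k₁ :=
      hAd.hasFDerivAt.comp_hasDerivAt k₁ hℓ
    rw [h110] at hφ
    have hGd : DifferentiableAt ℝ (fun x : ℝ => (dispersion ω₂ x + dispersion ω₂ k₂) * dispersion ω₂ x * dispersion ω₂ k₂) k₁ := by
      have c1 : Differentiable ℝ fun x : ℝ => dispersion ω₂ x := hd
      exact (((c1.add_const _).mul c1).mul_const _).differentiableAt
    have hL := hφ.mul hGd.hasDerivAt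
    rw [hA0] at hL
    simp only [zero_mul, add_zero] at hL
    -- the right-hand side along the same line
    have hm : HasDerivAt (fun x : ℝ => ((x, k₂) : ℝ × ℝ)) ((1, 0) : ℝ × ℝ) k₁ :=
      (hasDerivAt_id k₁).prodMk (hasDerivAt_const k₁ k₂)
    have hR := (hHd.hasFDerivAt.comp_hasDerivAt k₁ hm).const_mul τ
    have hfun : ((fun x : ℝ => A (x, x + c, k₂)) * fun x : ℝ =>
        (dispersion ω₂ x + dispersion ω₂ k₂) * dispersion ω₂ x * dispersion ω₂ k₂) =
        fun x : ℝ => τ * (Hf ∘ fun x : ℝ => ((x, k₂) : ℝ × ℝ)) x := by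
      funext x; simp only [Pi.mul_apply, Function.comp_apply, hHf]; exact hid x k₂
    rw [hfun] at hL
    have := hL.unique hR
    -- `0 = τ * fderiv Hf (k₁,k₂) (1,0)`
    have h := (mul_eq_zero.1 this.symm).resolve_left hτ
    exact h
  · -- differentiate in `y`
    have hℓ : HasDerivAt (fun y : ℝ => ((k₁, k₁ + c, y) : ℝ × ℝ × ℝ)) ((0, 0, 1) : ℝ × ℝ × ℝ) k₂ := by
      refine (hasDerivAt_const k₂ k₁).prodMk ((hasDerivAt_const k₂ (k₁ + c)).prodMk (hasDerivAt_id k₂))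
    have hφ : HasDerivAt (fun y : ℝ => A (k₁, k₁ + c, y)) (fderiv ℝ A (k₁, k₁ + c, k₂) (0, 0, 1)) k₂ :=
      hAd.hasFDerivAt.comp_hasDerivAt k₂ hℓ
    rw [h001] at hφ
    have hGd : DifferentiableAt ℝ (fun y : ℝ => (dispersion ω₂ k₁ + dispersion ω₂ y) * dispersion ω₂ k₁ * dispersion ω₂ y) k₂ := by
      have c1 : Differentiable ℝ fun y : ℝ => dispersion ω₂ y := hd
      exact (((c1.const_add _).mul_const _).mul c1).differentiableAt
    have hL := hφ.mul hGd.hasDerivAt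
    rw [hA0] at hL
    simp only [zero_mul, add_zero] at hL
    have hm : HasDerivAt (fun y : ℝ => ((k₁, y) : ℝ × ℝ)) ((0, 1) : ℝ × ℝ) k₂ :=
      (hasDerivAt_const k₂ k₁).prodMk (hasDerivAt_id k₂)
    have hR := (hHd.hasFDerivAt.comp_hasDerivAt k₂ hm).const_mul τ
    have hfun : ((fun y : ℝ => A (k₁, k₁ + c, y)) * fun y : ℝ =>
        (dispersion ω₂ k₁ + dispersion ω₂ y) * dispersion ω₂ k₁ * dispersion ω₂ y) =
        fun y : ℝ => τ * (Hf ∘ fun y : ℝ => ((k₁, y) : ℝ × ℝ)) y := by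
      funext y; simp only [Pi.mul_apply, Function.comp_apply, hHf]; exact hid k₁ y
    rw [hfun] at hL
    have := hL.unique hR
    exact (mul_eq_zero.1 this.symm).resolve_left hτ

/-! ### Along the second exchange plane -/

/-- **Registered sub-goal `tangential_nondeg_snd` (L7b): tangential non-degeneracy on a translate of the second
exchange plane** `{p.2.1 = p.2.2 + c}`: if `A(x, y+c, y)·((ω x + ω y) ω x ω y) = τ·H₀(x,y)` for all `x y` (`τ ≠ 0`)
and `A(k₁, k₂+c, k₂) = 0`, then `fderiv A (k₁,k₂+c,k₂) (1,0,0) ≠ 0 ∨ fderiv A (k₁,k₂+c,k₂) (0,1,1) ≠ 0`.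
[folklore] -/
theorem tangential_nondeg_snd :
    ∀ ω₂ : ℝ, 0 < ω₂ → ∀ (A : ℝ × ℝ × ℝ → ℝ) (c τ k₁ k₂ : ℝ), τ ≠ 0 → ContDiff ℝ 1 A →
      (∀ x y : ℝ, A (x, y + c, y) * ((dispersion ω₂ x + dispersion ω₂ y) * dispersion ω₂ x * dispersion ω₂ y) =
        τ * (2 * (dispersion ω₂ x * dispersion ω₂ y + ω₂ + 2) * Real.cos ((x + y) / 2) - 4 * Real.cos ((x - y) / 2))) →
      A (k₁, k₂ + c, k₂) = 0 →
      fderiv ℝ A (k₁, k₂ + c, k₂) (1, 0, 0) ≠ 0 ∨ fderiv ℝ A (k₁, k₂ + c, k₂) (0, 1, 1) ≠ 0 := by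
  intro ω₂ hω A c τ k₁ k₂ hτ hA hid hA0
  have hd : Differentiable ℝ (dispersion ω₂) := fun k => (hasDerivAt_dispersion hω k).differentiableAt
  have hAd : DifferentiableAt ℝ A (k₁, k₂ + c, k₂) := (hA.differentiable one_ne_zero) _
  set Hf : ℝ × ℝ → ℝ := fun q => 2 * (dispersion ω₂ q.1 * dispersion ω₂ q.2 + ω₂ + 2) * Real.cos ((q.1 + q.2) / 2) -
      4 * Real.cos ((q.1 - q.2) / 2) with hHf
  have hHd : DifferentiableAt ℝ Hf (k₁, k₂) := (differentiable_sheetFn_plane hω) _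
  have hH0 : Hf (k₁, k₂) = 0 := by
    have := hid k₁ k₂
    rw [hA0, zero_mul] at this
    have h := (mul_eq_zero.1 this.symm).resolve_left hτ
    simpa [hHf] using h
  have hreg := sheetFn_plane_regular ω₂ hω k₁ k₂ hH0
  by_contra hcon
  push Not at hcon
  obtain ⟨h100, h011⟩ := hcon
  apply hreg
  refine clm_two_eq_zero_of_basis ?_ ?_
  · have hℓ : HasDerivAt (fun x : ℝ => ((x, k₂ + c, k₂) : ℝ × ℝ × ℝ)) ((1, 0, 0) : ℝ × ℝ × ℝ) k₁ :=
      (hasDerivAt_id k₁).prodMk ((hasDerivAt_const k₁ (k₂ + c)).prodMk (hasDerivAt_const k₁ k₂))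
    have hφ : HasDerivAt (fun x : ℝ => A (x, k₂ + c, k₂)) (fderiv ℝ A (k₁, k₂ + c, k₂) (1, 0, 0)) k₁ :=
      hAd.hasFDerivAt.comp_hasDerivAt k₁ hℓ
    rw [h100] at hφ
    have hGd : DifferentiableAt ℝ (fun x : ℝ => (dispersion ω₂ x + dispersion ω₂ k₂) * dispersion ω₂ x * dispersion ω₂ k₂) k₁ := by
      have c1 : Differentiable ℝ fun x : ℝ => dispersion ω₂ x := hd
      exact (((c1.add_const _).mul c1).mul_const _).differentiableAt
    have hL := hφ.mul hGd.hasDerivAt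
    rw [hA0] at hL
    simp only [zero_mul, add_zero] at hL
    have hm : HasDerivAt (fun x : ℝ => ((x, k₂) : ℝ × ℝ)) ((1, 0) : ℝ × ℝ) k₁ :=
      (hasDerivAt_id k₁).prodMk (hasDerivAt_const k₁ k₂)
    have hR := (hHd.hasFDerivAt.comp_hasDerivAt k₁ hm).const_mul τ
    have hfun : ((fun x : ℝ => A (x, k₂ + c, k₂)) * fun x : ℝ =>
        (dispersion ω₂ x + dispersion ω₂ k₂) * dispersion ω₂ x * dispersion ω₂ k₂) =
        fun x : ℝ => τ * (Hf ∘ fun x : ℝ => ((x, k₂) : ℝ × ℝ)) x := by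
      funext x; simp only [Pi.mul_apply, Function.comp_apply, hHf]; exact hid x k₂
    rw [hfun] at hL
    have := hL.unique hR
    exact (mul_eq_zero.1 this.symm).resolve_left hτ
  · have hℓ : HasDerivAt (fun y : ℝ => ((k₁, y + c, y) : ℝ × ℝ × ℝ)) ((0, 1, 1) : ℝ × ℝ × ℝ) k₂ :=
      (hasDerivAt_const k₂ k₁).prodMk (((hasDerivAt_id k₂).add_const c).prodMk (hasDerivAt_id k₂))
    have hφ : HasDerivAt (fun y : ℝ => A (k₁, y + c, y)) (fderiv ℝ A (k₁, k₂ + c, k₂) (0, 1, 1)) k₂ :=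
      hAd.hasFDerivAt.comp_hasDerivAt k₂ hℓ
    rw [h011] at hφ
    have hGd : DifferentiableAt ℝ (fun y : ℝ => (dispersion ω₂ k₁ + dispersion ω₂ y) * dispersion ω₂ k₁ * dispersion ω₂ y) k₂ := by
      have c1 : Differentiable ℝ fun y : ℝ => dispersion ω₂ y := hd
      exact (((c1.const_add _).mul_const _).mul c1).differentiableAt
    have hL := hφ.mul hGd.hasDerivAt
    rw [hA0] at hL
    simp only [zero_mul, add_zero] at hL
    have hm : HasDerivAt (fun y : ℝ => ((k₁, y) : ℝ × ℝ)) ((0, 1) : ℝ × ℝ) k₂ :=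
      (hasDerivAt_const k₂ k₁).prodMk (hasDerivAt_id k₂)
    have hR := (hHd.hasFDerivAt.comp_hasDerivAt k₂ hm).const_mul τ
    have hfun : ((fun y : ℝ => A (k₁, y + c, y)) * fun y : ℝ =>
        (dispersion ω₂ k₁ + dispersion ω₂ y) * dispersion ω₂ k₁ * dispersion ω₂ y) =
        fun y : ℝ => τ * (Hf ∘ fun y : ℝ => ((k₁, y) : ℝ × ℝ)) y := by
      funext y; simp only [Pi.mul_apply, Function.comp_apply, hHf]; exact hid k₁ y
    rw [hfun] at hL
    have := hL.unique hR
    exact (mul_eq_zero.1 this.symm).resolve_left hτ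

/-! ### Along the diagonal -/

/-- A diagonal zero of the restricted sheet function is a triple point: `H₀(k,k) = 0 ⇒ cos k = c*`. [folklore] -/
theorem cos_eq_cosKappaStar_of_sheetFn_diag_eq_zero {ω₂ : ℝ} (hω : 0 < ω₂) {k : ℝ}
    (h : 2 * (dispersion ω₂ k * dispersion ω₂ k + ω₂ + 2) * Real.cos ((k + k) / 2) - 4 * Real.cos ((k - k) / 2) = 0) :
    Real.cos k = cosKappaStar ω₂ := by
  rw [show (k + k) / 2 = k by ring, sub_self, zero_div, Real.cos_zero, mul_one, ← sq, dispersion_sq hω.le] at h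
  have hq : Real.cos k ^ 2 - (ω₂ + 2) * Real.cos k + 1 = 0 := by nlinarith [h]
  exact (deriv_groupVelocity_eq_zero_iff_cos hω k).1 ((deriv_groupVelocity_eq_zero_iff hω k).2 hq)

/-- **Registered sub-goal `diagonal_nondeg` (L7b): diagonal non-degeneracy of the transversal coordinate at a
triple point.** For `ω₂ > 0`, `A ∈ C¹`, `τ ≠ 0`, constants `c, c′`: if
`A(x, x+c, x+c′)·((ω x + ω x) ω x ω x) = τ·H₀(x,x)` for all `x` and `A(k, k+c, k+c′) = 0`, then
`fderiv A (k, k+c, k+c′) (1,1,1) ≠ 0`. [folklore] -/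
theorem diagonal_nondeg :
    ∀ ω₂ : ℝ, 0 < ω₂ → ∀ (A : ℝ × ℝ × ℝ → ℝ) (c c' τ k : ℝ), τ ≠ 0 → ContDiff ℝ 1 A →
      (∀ x : ℝ, A (x, x + c, x + c') * ((dispersion ω₂ x + dispersion ω₂ x) * dispersion ω₂ x * dispersion ω₂ x) =
        τ * (2 * (dispersion ω₂ x * dispersion ω₂ x + ω₂ + 2) * Real.cos ((x + x) / 2) - 4 * Real.cos ((x - x) / 2))) →
      A (k, k + c, k + c') = 0 →
      fderiv ℝ A (k, k + c, k + c') (1, 1, 1) ≠ 0 := by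
  intro ω₂ hω A c c' τ k hτ hA hid hA0 hD
  have hd : Differentiable ℝ (dispersion ω₂) := fun x => (hasDerivAt_dispersion hω x).differentiableAt
  have hAd : DifferentiableAt ℝ A (k, k + c, k + c') := (hA.differentiable one_ne_zero) _
  -- the diagonal zero is a triple point
  have hG0 : 0 < (dispersion ω₂ k + dispersion ω₂ k) * dispersion ω₂ k * dispersion ω₂ k :=
    mul_pos (mul_pos (add_pos (dispersion_pos hω k) (dispersion_pos hω k)) (dispersion_pos hω k)) (dispersion_pos hω k)
  have hH0 : 2 * (dispersion ω₂ k * dispersion ω₂ k + ω₂ + 2) * Real.cos ((k + k) / 2) - 4 * Real.cos ((k - k) / 2) = 0 := by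
    have := hid k
    rw [hA0, zero_mul] at this
    exact (mul_eq_zero.1 this.symm).resolve_left hτ
  have hck := cos_eq_cosKappaStar_of_sheetFn_diag_eq_zero hω hH0
  obtain ⟨-, hg, hne⟩ := sheetFn_diag_deriv_ne_zero ω₂ hω k hck
  -- differentiate the identity along `t ↦ (k+t, k+c+t, k+c′+t)`
  have hℓ : HasDerivAt (fun t : ℝ => ((k + t, k + c + t, k + c' + t) : ℝ × ℝ × ℝ)) ((1, 1, 1) : ℝ × ℝ × ℝ) 0 := by
    have h1 : HasDerivAt (fun t : ℝ => k + t) 1 0 := by simpa using (hasDerivAt_id (0 : ℝ)).const_add k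
    have h2 : HasDerivAt (fun t : ℝ => k + c + t) 1 0 := by simpa using (hasDerivAt_id (0 : ℝ)).const_add (k + c)
    have h3 : HasDerivAt (fun t : ℝ => k + c' + t) 1 0 := by simpa using (hasDerivAt_id (0 : ℝ)).const_add (k + c')
    exact h1.prodMk (h2.prodMk h3)
  have hAd0 : DifferentiableAt ℝ A (k + 0, k + c + 0, k + c' + 0) := by simpa using hAd
  have hφ : HasDerivAt (fun t : ℝ => A (k + t, k + c + t, k + c' + t))
      (fderiv ℝ A (k + 0, k + c + 0, k + c' + 0) (1, 1, 1)) 0 := hAd0.hasFDerivAt.comp_hasDerivAt 0 hℓ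
  simp only [add_zero] at hφ
  rw [hD] at hφ
  have hGd : DifferentiableAt ℝ (fun t : ℝ => (dispersion ω₂ (k + t) + dispersion ω₂ (k + t)) * dispersion ω₂ (k + t) *
      dispersion ω₂ (k + t)) 0 := by
    have c1 : Differentiable ℝ fun t : ℝ => dispersion ω₂ (k + t) := hd.comp (differentiable_id.const_add k)
    exact (((c1.add c1).mul c1).mul c1).differentiableAt
  have hL := hφ.mul hGd.hasDerivAt
  simp only [add_zero] at hL
  rw [hA0] at hL
  simp only [zero_mul, add_zero] at hL
  -- the right-hand side: `τ · g`, `g t = 2(ω(k+t)² + ω₂ + 2)cos(k+t) − 4`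
  have hR := hg.const_mul τ
  have hfun : ((fun t : ℝ => A (k + t, k + c + t, k + c' + t)) * fun t : ℝ =>
      (dispersion ω₂ (k + t) + dispersion ω₂ (k + t)) * dispersion ω₂ (k + t) * dispersion ω₂ (k + t)) =
      fun t : ℝ => τ * (2 * (dispersion ω₂ (k + t) ^ 2 + ω₂ + 2) * Real.cos (k + t) - 4) := by
    funext t
    simp only [Pi.mul_apply]
    have := hid (k + t)
    rw [show k + t + c = k + c + t by ring, show k + t + c' = k + c' + t by ring] at this
    rw [this, show (k + t + (k + t)) / 2 = k + t by ring, sub_self, zero_div, Real.cos_zero, mul_one, ← sq]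
  rw [hfun] at hL
  have := hL.unique hR
  exact hne ((mul_eq_zero.1 this.symm).resolve_left hτ)

end Summit.AtomisticToContinuum.FouriersLaw.Theorems.DrudeDissolution.KineticPolymerGasOnTheTimeAxis

end
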